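import Literature.AlgebraicGeometry.HodgeTheory.VHSDataFlatCharts
import Literature.AlgebraicGeometry.HodgeTheory.VHSDataLocallyChartedLift
import Literature.AlgebraicGeometry.Motives.FamiliesVHSComapCovering
import HarnessLib

/-!
# Locally flat-charted variations: flat interior charts from FLAT HOLOMORPHIC LIFTS on small coordinate balls, Cattani–Deligne–Kaplan's
# Corollary 1.3 (`r = 1`) for every tensor construction without a comparison hypothesis, and its DESCENT along covering maps

Topic `Literature/AlgebraicGeometry/HodgeTheory` (namespace `Literature.AlgebraicGeometry.Motives.VHSData[.InteriorChart ∕ .IsLocallyFlatCharted]`),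
lane `lit-hodgefound` (seat `p08`, row g59-#2); the flat companion of `VHSDataLocallyChartedLift` (`IsLocallyCharted`: Thm 1.1 ∕ Cor 1.2 for the
norm-bounded loci from interior charts on SMALL coordinate balls, as delivered by holomorphic lifts of the period map) over `VHSDataFlatCharts`
(`InteriorChart.IsFlat`, `PunctureChart.IsFlat`, `IsFlatCharted`, Cor. 1.3 for all tensor constructions).  ONE DEFINITION WITH BODY — the `Prop`-valued
predicate **`IsLocallyFlatCharted D ψ σ`** — and THEOREMS; no named fact, no instance, no notation (D-0026 net debt `0`).

PRINTED SOURCE, VERBATIM (E. Cattani, P. Deligne, A. Kaplan, *On the locus of Hodge classes*, J. Amer. Math. Soc. 8 (1995)).  p. 484: «**Corollary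
1.3.** Let `u` be a section of the local system `𝒱_ℤ` on a universal covering of `S`. The set of points in `S` where some determination of `u` is of
type `(0, 0)` is an algebraic subvariety of `S`.»  p. 485, «Proof of 1.5 ⟹ 1.1»: «To prove 1.1 one is free to replace `S` by a finite etale covering
`S′ → S`.»  (2.4) (p. 488): «on `ℋ^r`, the pullback of the local system `𝒱_ℤ` can be trivialized.»  W. Schmid, Invent. Math. 22 (1973), §2–§3:
flat frames over simply connected bases; holomorphic lifts of the period map.

CONTENT.
* §1 `InteriorChart.IsFlat.restrBall ∕ restrBallMono` — flatness survives shrinking the disc to a coordinate ball (fewer paths).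
* §2 **`exists_isFlat_interiorChart_restrBall_of_lift`** — a FLAT interior chart on a small coordinate ball from a FLAT holomorphic lift (the tree's
  `exists_interiorChart_restrBall_of_lift` — comparison constant `κ = 1/2` from the continuity of the Hodge metric — run again keeping track of the
  trivializations, so that their flatness along in-disc paths passes to the chart).
* §3 **`IsLocallyFlatCharted D ψ σ`** (a flat interior chart on some coordinate ball around EVERY point of every disc; flat puncture charts along the
  ends), `IsFlatCharted.isLocallyFlatCharted`, `IsLocallyFlatCharted.isLocallyCharted`, **`of_lift`** (locally flat-charted from flat holomorphic lifts
  and flat puncture charts — NO comparison of Hodge metrics assumed).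
* §4 closure under `tensor ∕ cast ∕ tateTwist ∕ dual ∕ const ∕ tate ∕ unit ∕ tensorPow ∕ tensorSpace ∕ hom`.
* §5 **`IsLocallyFlatCharted.determinationLocus_eq_univ_or_finite(_of_compactification)`** (COR. 1.3, `r = 1`), and for `T^{a,b}D`, `Hom(D₁, D₂)`.
* §6 DESCENT «replace `S` by a finite etale covering»: **`determinationLocus_eq_univ_or_finite_of_comap_covering`** — if `f^*D` is locally flat-charted
  on a surjective covering `f : S′ → S` (open ends, compact core, continuous ends upstairs), the set of points of `S` where some determination of `u₀` is
  of type `(p, p)` is `S` or finite; the same for `D₁ ⊗ D₂` (`f^*(D₁ ⊗ D₂) = f^*D₁ ⊗ f^*D₂`), **`T^{a,b}D`** (`f^*T^{a,b}D ≅ T^{a,b}f^*D`, the tree's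
  `Iso.tensorSpaceComap`, determination loci are invariant under isomorphisms) and **`Hom(D₁, D₂)`** (`Iso.homComap`).
* §7 (appended, row g59-#4) **`IsLocallyFlatCharted.of_pointwise_lift`**: locally flat-charted from flat holomorphic-lift data chosen PER POINT of each
  disc (reference structure = the Hodge structure at the point, `g → 1` there; reference spaces and flat puncture charts existential) — the form in
  which flat frames and lifts of the period map arise; `of_lift` is the special case of one datum per disc.
* §8 (appended, row g59-#7) INTERIOR CHARTS ONLY, ANY PRECONNECTED BASE (a disc, the half-plane, …): the Hodge locus of norm `≤ K` of a locally
  charted `D`, and the set of Cor. 1.3 for a locally flat-charted `D`, are CLOSED and either everything or avoided by a punctured neighbourhood of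
  every point (`IsLocallyCharted.isClosed_hodgeLocusOfNormLe_and_eq_univ_or_forall_eventually_not_mem`,
  `IsLocallyFlatCharted.isClosed_determinationLocus_and_eq_univ_or_forall_eventually_not_mem`; the tree's `Topology.eq_univ_or_forall_eventually_not_mem`).

HONEST SCOPE.  Hypothesis structures throughout (`VHSData` records neither holomorphy nor Griffiths transversality); the existence of flat holomorphic
lifts on simply connected coordinate discs and of flat puncture charts (nilpotent orbit theorem) for an honest polarized `ℤ`VHS is cited, not
constructed.  Not here: bases of dimension `≥ 2`; `r ≥ 2`.

## References

* [CattaniDeligneKaplan1995] E. Cattani, P. Deligne, A. Kaplan, *On the locus of Hodge classes*, J. Amer. Math. Soc. 8 (1995) 483–506: §1 (pp. 483–484),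
  Cor. 1.3 (p. 484), Thm. 1.5 and «Proof of 1.5 ⟹ 1.1» (p. 485), 2.1 (p. 486), 2.3 (p. 487), (2.4) (p. 488), 2.7 (p. 489).
* [Schmid1973] W. Schmid, *Variation of Hodge structure: the singularities of the period mapping*, Invent. Math. 22 (1973), §2, §3, (4.9)–(4.12) (cite only).
* [CattaniKaplanSchmid1987] E. Cattani, A. Kaplan, W. Schmid, *Variations of polarized Hodge structure: asymptotics and monodromy*, LNM 1246 (1987), §3,
  proof of Cor. (3.7) (continuity of the Hodge metric; cite only).
* [Deligne1970] P. Deligne, *Équations différentielles à points singuliers réguliers*, LNM 163 (1970), I.1.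
* [Deligne1982HodgeCycles] P. Deligne, *Hodge cycles on abelian varieties*, LNM 900 (1982), I §3, 3.1–3.4, Prop. 3.6.
* [DeligneHodgeII1971] P. Deligne, *Théorie de Hodge II*, Publ. Math. IHÉS 40 (1971), 2.1.13–2.1.15.
* [FritzscheGrauert2002] K. Fritzsche, H. Grauert, *From Holomorphic Functions to Complex Manifolds*, GTM 213 (2002), Ch. I §8.
-/

noncomputable section

open scoped TensorProduct
open _root_.Topology _root_.Filter Set

universe u

namespace Literature.AlgebraicGeometry

open Module
open Motives Motives.MixedHodgeStructure Motives.HodgeStructure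
open Motives.HodgeStructure (conj ofRat ofRat_apply conj_ofRat)
open HodgeTheory Topology

/-- For mutually inverse endomorphisms `g`, `h` of a module and a submodule `F`: `h⁻¹(F) = g(F)`. [folklore] -/
private theorem comap_eq_map_of_inverse'' {R M : Type*} [CommSemiring R] [AddCommMonoid M] [Module R M] (F : Submodule R M) {g h : M →ₗ[R] M}
    (hgh : ∀ w, g (h w) = w) (hhg : ∀ w, h (g w) = w) : F.comap h = F.map g := by
  ext y
  rw [Submodule.mem_comap, Submodule.mem_map]
  constructor
  · intro hy
    exact ⟨h y, hy, hgh y⟩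
  · rintro ⟨x, hx, rfl⟩
    rwa [hhg]

/-! ## §1 Flatness survives shrinking the disc -/

namespace HodgeTheory

variable {S : Type*} [TopologicalSpace S]

/-- The source of the shrunk disc lies in the source of the disc. [cite: FritzscheGrauert2002, Ch. I §8] -/
theorem restrBall_source_subset (ψ : OpenPartialHomeomorph S ℂ) (x : S) (r : ℝ) : (Topology.restrBall ψ x r).source ⊆ ψ.source :=
  fun _ hy => ((mem_restrBall_source ψ x r).1 hy).1

/-- Concentric shrunk discs have nested sources. [cite: FritzscheGrauert2002, Ch. I §8] -/
theorem restrBall_source_mono (ψ : OpenPartialHomeomorph S ℂ) (x : S) {r₁ r₂ : ℝ} (hr : r₂ ≤ r₁) :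
    (Topology.restrBall ψ x r₂).source ⊆ (Topology.restrBall ψ x r₁).source := fun _ hy =>
  (mem_restrBall_source ψ x r₁).2 ⟨((mem_restrBall_source ψ x r₂).1 hy).1, Metric.ball_subset_ball hr ((mem_restrBall_source ψ x r₂).1 hy).2⟩

end HodgeTheory

namespace Motives.VHSData

variable {S : Type} [TopologicalSpace S] {k k' k₁ k₂ : ℤ} {D : VHSData S k}
variable {V : Type u} [AddCommGroup V] [Module ℚ V]

namespace InteriorChart

variable {ψ : OpenPartialHomeomorph S ℂ} {H₀ : HodgeStructure V k} {P₀ : H₀.Polarization}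

/-- **A flat interior chart restricts to a flat chart on every coordinate ball inside its disc** (same trivializations; a path inside the ball is a
path inside the disc). [cite: Schmid1973, §2] [cite: CattaniDeligneKaplan1995, §1 (pp. 483–484)] -/
theorem IsFlat.restrBall {C : D.InteriorChart ψ P₀} (hC : C.IsFlat) {x : S} {r : ℝ} (hB : Metric.ball (ψ x) r ⊆ ψ.target) :
    (C.restrBall hB).IsFlat :=
  fun _ _ hc hc' γ hγ y => hC (restrBall_target_subset ψ x r hc) (restrBall_target_subset ψ x r hc') γ
    (fun t => HodgeTheory.restrBall_source_subset ψ x r (hγ t)) y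

/-- A flat chart on a coordinate ball restricts to a flat chart on every smaller concentric ball. [cite: Schmid1973, §2] -/
theorem IsFlat.restrBallMono {x : S} {r₁ r₂ : ℝ} {C : D.InteriorChart (Topology.restrBall ψ x r₁) P₀} (hC : C.IsFlat) (hr : r₂ ≤ r₁)
    (hB : Metric.ball (ψ x) r₂ ⊆ ψ.target) : (C.restrBallMono hr hB).IsFlat :=
  fun _ _ hc hc' γ hγ y => hC (restrBall_target_mono ψ x hr hc) (restrBall_target_mono ψ x hr hc') γ
    (fun t => HodgeTheory.restrBall_source_mono ψ x hr (hγ t)) y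

end InteriorChart

/-! ## §2 A FLAT interior chart on a small coordinate ball from a FLAT holomorphic lift -/

section Lift

variable (D)
variable [FiniteDimensional ℚ V]

/-- **A FLAT INTERIOR CHART FROM A FLAT HOLOMORPHIC LIFT.**  Data as in the tree's `exists_interiorChart_restrBall_of_lift` (`ψ` a coordinate disc
with `x ∈ ψ.source`; `e c : V_{ψ⁻¹(c)} ≃ V` carrying every `F^q` to `g(c)·F₀^q`, `Q` to `Q₀`, `V_ℤ` ONTO the finitely generated `Λ`; `g`, `h` mutually
inverse, `h` weakly holomorphic, `g(c) → 1` weakly at `ψ x`) AND the trivializations flat along every path inside the disc (`e_{c′}(γ · y) = e_c(y)`: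
the frame of flat sections over a simply connected disc).  Then **on some coordinate ball around `ψ x` the datum is a FLAT `InteriorChart`** (frame
`h`, constant `κ = 1/2` by continuity of the Hodge metric). [cite: CattaniDeligneKaplan1995, §1 (pp. 483–484)] [cite: Schmid1973, §2 and §3 (cite only)]
[cite: CattaniKaplanSchmid1987, §3 proof of Cor. (3.7) (cite only)] -/
theorem exists_isFlat_interiorChart_restrBall_of_lift (ψ : OpenPartialHomeomorph S ℂ) {x : S} (hx : x ∈ ψ.source)
    (e : ∀ c : ℂ, D.V.fiber (ψ.symm c) ≃ₗ[ℚ] V) (H₀ : HodgeStructure V k) (P₀ : H₀.Polarization)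
    (g h : ℂ → Module.End ℂ (ℂ ⊗[ℚ] V)) (hgh : ∀ c ∈ ψ.target, ∀ w, g c (h c w) = w) (hhg : ∀ c ∈ ψ.target, ∀ w, h c (g c w) = w)
    (hh : ∀ (φ : Module.Dual ℂ (ℂ ⊗[ℚ] V)) (w : ℂ ⊗[ℚ] V), AnalyticOnNhd ℂ (fun c => φ (h c w)) ψ.target)
    (hg1 : ∀ (w : ℂ ⊗[ℚ] V) (φ : (ℂ ⊗[ℚ] V) →ₗ[ℂ] ℂ), Tendsto (fun c => φ (g c w)) (𝓝 (ψ x)) (𝓝 (φ w)))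
    (hF : ∀ c ∈ ψ.target, ∀ q : ℤ, ((D.hodge (ψ.symm c)).F q).map ((e c).toLinearMap.baseChange ℂ) = (H₀.F q).map (g c))
    (hQ : ∀ c ∈ ψ.target, ∀ x y : D.V.fiber (ψ.symm c), (D.form (ψ.symm c)).form x y = P₀.form (e c x) (e c y))
    (Λ : Submodule ℤ V) (hΛ : Λ.FG) (hΛ₁ : ∀ c ∈ ψ.target, ∀ u : D.VZ.fiber (ψ.symm c), e c (D.toRat (ψ.symm c) u) ∈ Λ)
    (hΛ₂ : ∀ c ∈ ψ.target, ∀ v ∈ Λ, ∃ u : D.VZ.fiber (ψ.symm c), e c (D.toRat (ψ.symm c) u) = v)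
    (hflat : ∀ ⦃c c' : ℂ⦄, c ∈ ψ.target → c' ∈ ψ.target → ∀ γ : Path (ψ.symm c) (ψ.symm c'), (∀ t, γ t ∈ ψ.source) →
      ∀ y : D.V.fiber (ψ.symm c), e c' (D.V.transport (Path.Homotopic.Quotient.mk γ) y) = e c y) :
    ∃ r > 0, Metric.ball (ψ x) r ⊆ ψ.target ∧ ∃ C : D.InteriorChart (restrBall ψ x r) P₀, C.IsFlat := by
  have hc₀ : ψ x ∈ ψ.target := ψ.map_source hx
  have hev := D.eventually_hodgeNorm_fiber_baseChange_mem_Icc_of_lift ψ.symm ψ.open_target hc₀ e H₀ P₀ g hg1 hF hQ (ε := 1 / 2) (by norm_num)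
  obtain ⟨r, hr, hball⟩ := Metric.mem_nhds_iff.1 hev
  have hBU : Metric.ball (ψ x) r ⊆ ψ.target := fun c hc => (hball hc).1
  have hT : ∀ c ∈ (restrBall ψ x r).target, c ∈ Metric.ball (ψ x) r := fun c hc => by rwa [restrBall_target ψ hBU] at hc
  refine ⟨r, hr, hBU, {
    isPreconnected_target := isPreconnected_restrBall_target ψ hBU
    e := e
    h := h
    analyticOnNhd_h := fun φ w => (hh φ w).mono (restrBall_target_subset ψ x r)
    isUnit_h := fun c hc =>
      ⟨⟨h c, g c, LinearMap.ext (hhg c (hBU (hT c hc))), LinearMap.ext (hgh c (hBU (hT c hc)))⟩, rfl⟩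
    map_F_eq := fun c hc q => by
      rw [comap_eq_map_of_inverse'' (H₀.F q) (hgh c (hBU (hT c hc))) (hhg c (hBU (hT c hc)))]
      exact hF c (hBU (hT c hc)) q
    form_eq := fun c hc => hQ c (hBU (hT c hc))
    Λ := Λ
    fg_Λ := hΛ
    e_toRat_mem := fun c hc => hΛ₁ c (hBU (hT c hc))
    exists_e_toRat_eq := fun c hc => hΛ₂ c (hBU (hT c hc))
    κ := 1 / 2
    κ_pos := by norm_num
    mul_hodgeNorm_le := fun c hc y => by
      have h1 := ((hball (hT c hc)).2 y).1
      norm_num at h1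
      exact h1 }, fun c c' hc hc' γ hγ y => ?_⟩
  exact hflat (restrBall_target_subset ψ x r hc) (restrBall_target_subset ψ x r hc') γ
    (fun t => HodgeTheory.restrBall_source_subset ψ x r (hγ t)) y

end Lift

/-! ## §3 Locally flat-charted variations -/

variable {α ι : Type*} (ψ : α → OpenPartialHomeomorph S ℂ) (σ : ι → ℂ → S)

variable (D) in
/-- **`D` is LOCALLY FLAT-CHARTED** with respect to the coordinate discs `ψ a` and the ends `σ i`: around EVERY point of every disc, on some coordinate
ball of that disc, a FLAT interior local period chart of `D` (for some reference data), and along every end a FLAT puncture chart — the form in which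
flat holomorphic lifts of the period map deliver flat interior charts (`exists_isFlat_interiorChart_restrBall_of_lift`), stable under the tensor
constructions. [cite: CattaniDeligneKaplan1995, §1 (pp. 483–484), Cor. 1.3, (2.4) (p. 488), 2.7 (p. 489)] [cite: Schmid1973, §2–§3 (cite only)] -/
structure IsLocallyFlatCharted : Prop where
  /-- a flat interior chart on a coordinate ball around every point of every disc -/
  interior : ∀ a, ∀ x ∈ (ψ a).source, ∃ r > 0, Metric.ball (ψ a x) r ⊆ (ψ a).target ∧
    ∃ (V : Type) (_ : AddCommGroup V) (_ : Module ℚ V) (_ : FiniteDimensional ℚ V) (H₀ : HodgeStructure V k) (P₀ : H₀.Polarization)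
      (C : D.InteriorChart (restrBall (ψ a) x r) P₀), C.IsFlat
  /-- a flat puncture chart along each end -/
  puncture : ∀ i, ∃ (V : Type) (_ : AddCommGroup V) (_ : Module ℚ V) (_ : FiniteDimensional ℚ V) (L : PolarizedLimitMixedHodgeStructure V k)
    (C : D.PunctureChart (σ i) L), C.IsFlat

variable {ψ σ}

/-- **Flat-charted ⟹ locally flat-charted** (shrink each flat interior chart to coordinate balls). [cite: CattaniDeligneKaplan1995, §1 (pp. 483–484)] -/
theorem IsFlatCharted.isLocallyFlatCharted (h : D.IsFlatCharted ψ σ) : D.IsLocallyFlatCharted ψ σ := by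
  refine ⟨fun a x hx => ?_, h.puncture⟩
  obtain ⟨r, hr, hB⟩ := exists_ball_subset_target (ψ a) hx
  obtain ⟨V, _, _, _, H₀, P₀, C, hC⟩ := h.interior a
  exact ⟨r, hr, hB, V, inferInstance, inferInstance, inferInstance, H₀, P₀, C.restrBall hB, hC.restrBall hB⟩

namespace IsLocallyFlatCharted

/-- A locally flat-charted variation is locally charted. [cite: CattaniDeligneKaplan1995, §1 (pp. 483–484)] -/
theorem isLocallyCharted (h : D.IsLocallyFlatCharted ψ σ) : D.IsLocallyCharted ψ σ := by
  refine ⟨fun a x hx => ?_, fun i => ?_⟩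
  · obtain ⟨r, hr, hB, V, _, _, _, H₀, P₀, C, -⟩ := h.interior a x hx
    exact ⟨r, hr, hB, V, inferInstance, inferInstance, inferInstance, H₀, P₀, ⟨C⟩⟩
  · obtain ⟨V, _, _, _, L, C, -⟩ := h.puncture i
    exact ⟨V, inferInstance, inferInstance, inferInstance, L, ⟨C⟩⟩

/-- **Locally flat-charted from FLAT HOLOMORPHIC LIFTS**: on every disc, flat holomorphic-lift data (as in
`exists_isFlat_interiorChart_restrBall_of_lift`, the weak limit `g(c) → 1` at every point of the disc), and flat puncture charts along the ends — NO
comparison of Hodge metrics is assumed. [cite: CattaniDeligneKaplan1995, §1 (pp. 483–484), (2.4) (p. 488)] [cite: Schmid1973, §2–§3 (cite only)] -/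
theorem of_lift {V : Type} [AddCommGroup V] [Module ℚ V] [FiniteDimensional ℚ V]
    (hint : ∀ a, ∃ (e : ∀ c : ℂ, D.V.fiber ((ψ a).symm c) ≃ₗ[ℚ] V) (H₀ : HodgeStructure V k) (P₀ : H₀.Polarization)
      (g h : ℂ → Module.End ℂ (ℂ ⊗[ℚ] V)) (Λ₀ : Submodule ℤ V),
      (∀ c ∈ (ψ a).target, ∀ w, g c (h c w) = w) ∧ (∀ c ∈ (ψ a).target, ∀ w, h c (g c w) = w) ∧
      (∀ (φ : Module.Dual ℂ (ℂ ⊗[ℚ] V)) (w : ℂ ⊗[ℚ] V), AnalyticOnNhd ℂ (fun c => φ (h c w)) (ψ a).target) ∧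
      (∀ x ∈ (ψ a).source, ∀ (w : ℂ ⊗[ℚ] V) (φ : (ℂ ⊗[ℚ] V) →ₗ[ℂ] ℂ), Tendsto (fun c => φ (g c w)) (𝓝 (ψ a x)) (𝓝 (φ w))) ∧
      (∀ c ∈ (ψ a).target, ∀ q : ℤ, ((D.hodge ((ψ a).symm c)).F q).map ((e c).toLinearMap.baseChange ℂ) = (H₀.F q).map (g c)) ∧
      (∀ c ∈ (ψ a).target, ∀ x y : D.V.fiber ((ψ a).symm c), (D.form ((ψ a).symm c)).form x y = P₀.form (e c x) (e c y)) ∧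
      Λ₀.FG ∧ (∀ c ∈ (ψ a).target, ∀ u : D.VZ.fiber ((ψ a).symm c), e c (D.toRat ((ψ a).symm c) u) ∈ Λ₀) ∧
      (∀ c ∈ (ψ a).target, ∀ v ∈ Λ₀, ∃ u : D.VZ.fiber ((ψ a).symm c), e c (D.toRat ((ψ a).symm c) u) = v) ∧
      (∀ ⦃c c' : ℂ⦄, c ∈ (ψ a).target → c' ∈ (ψ a).target → ∀ γ : Path ((ψ a).symm c) ((ψ a).symm c'), (∀ t, γ t ∈ (ψ a).source) →
        ∀ y : D.V.fiber ((ψ a).symm c), e c' (D.V.transport (Path.Homotopic.Quotient.mk γ) y) = e c y))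
    {L : ι → PolarizedLimitMixedHodgeStructure V k} (C : ∀ i, D.PunctureChart (σ i) (L i)) (hC : ∀ i, (C i).IsFlat) :
    D.IsLocallyFlatCharted ψ σ := by
  refine ⟨fun a x hx => ?_, fun i => ⟨V, inferInstance, inferInstance, inferInstance, L i, C i, hC i⟩⟩
  obtain ⟨e, H₀, P₀, g, h, Λ₀, hgh, hhg, hh, hg1, hF, hQ, hΛ, hΛ₁, hΛ₂, hflat⟩ := hint a
  obtain ⟨r, hr, hB, C', hC'⟩ :=
    D.exists_isFlat_interiorChart_restrBall_of_lift (ψ a) hx e H₀ P₀ g h hgh hhg hh (hg1 x hx) hF hQ Λ₀ hΛ hΛ₁ hΛ₂ hflat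
  exact ⟨r, hr, hB, V, inferInstance, inferInstance, inferInstance, H₀, P₀, C', hC'⟩

/-! ## §4 Locally flat-charted variations are closed under the tensor constructions -/

/-- **`D₁, D₂` locally flat-charted ⟹ `D₁ ⊗ D₂` locally flat-charted** (shrink both charts to the smaller ball, then `IsFlat.tensor`).
[cite: Schmid1973, §2] [cite: CattaniDeligneKaplan1995, §1 (pp. 483–484)] -/
theorem tensor {D₁ : VHSData S k₁} {D₂ : VHSData S k₂} (h₁ : D₁.IsLocallyFlatCharted ψ σ) (h₂ : D₂.IsLocallyFlatCharted ψ σ) :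
    (D₁.tensor D₂).IsLocallyFlatCharted ψ σ := by
  haveI : HodgeTensorFacts.{0, 0} := hodgeTensorFacts_holds
  refine ⟨fun a x hx => ?_, fun i => ?_⟩
  · obtain ⟨r₁, hr₁, hB₁, V₁, _, _, _, H₁, P₁, C₁, hC₁⟩ := h₁.interior a x hx
    obtain ⟨r₂, hr₂, hB₂, V₂, _, _, _, H₂, P₂, C₂, hC₂⟩ := h₂.interior a x hx
    have hB : Metric.ball (ψ a x) (min r₁ r₂) ⊆ (ψ a).target := (Metric.ball_subset_ball (min_le_left _ _)).trans hB₁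
    exact ⟨min r₁ r₂, lt_min hr₁ hr₂, hB, V₁ ⊗[ℚ] V₂, inferInstance, inferInstance, inferInstance, H₁.tensor H₂, P₁.tensor P₂,
      (C₁.restrBallMono (min_le_left _ _) hB).tensor (C₂.restrBallMono (min_le_right _ _) hB),
      (hC₁.restrBallMono (min_le_left _ _) hB).tensor (hC₂.restrBallMono (min_le_right _ _) hB)⟩
  · obtain ⟨V₁, _, _, _, L₁, C₁, hC₁⟩ := h₁.puncture i
    obtain ⟨V₂, _, _, _, L₂, C₂, hC₂⟩ := h₂.puncture i
    exact ⟨V₁ ⊗[ℚ] V₂, inferInstance, inferInstance, inferInstance, L₁.tensor L₂, C₁.tensor C₂, hC₁.tensor hC₂⟩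

/-- `D` locally flat-charted ⟹ `D.cast h` locally flat-charted. [cite: CattaniDeligneKaplan1995, §1 (pp. 483–484)] -/
theorem cast (h : D.IsLocallyFlatCharted ψ σ) (e : k = k') : (D.cast e).IsLocallyFlatCharted ψ σ := by
  refine ⟨fun a x hx => ?_, fun i => ?_⟩
  · obtain ⟨r, hr, hB, V, _, _, _, H₀, P₀, C, hC⟩ := h.interior a x hx
    exact ⟨r, hr, hB, V, inferInstance, inferInstance, inferInstance, _, P₀.cast e, C.cast e, hC.cast e⟩
  · obtain ⟨V, _, _, _, L, C, hC⟩ := h.puncture i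
    exact ⟨V, inferInstance, inferInstance, inferInstance, L.cast e, C.cast e, hC.cast e⟩

/-- `D` locally flat-charted ⟹ `D(j)` locally flat-charted. [cite: DeligneHodgeII1971, 2.1.14] [cite: CattaniDeligneKaplan1995, §1 (pp. 483–484)] -/
theorem tateTwist (h : D.IsLocallyFlatCharted ψ σ) (j : ℤ) : (D.tateTwist j).IsLocallyFlatCharted ψ σ := by
  refine ⟨fun a x hx => ?_, fun i => ?_⟩
  · obtain ⟨r, hr, hB, V, _, _, _, H₀, P₀, C, hC⟩ := h.interior a x hx
    exact ⟨r, hr, hB, V, inferInstance, inferInstance, inferInstance, _, P₀.tateTwist j, C.tateTwist j, hC.tateTwist j⟩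
  · obtain ⟨V, _, _, _, L, C, hC⟩ := h.puncture i
    exact ⟨V, inferInstance, inferInstance, inferInstance, L.tateTwist j, C.tateTwist j, hC.tateTwist j⟩

/-- **`D` locally flat-charted ⟹ `D^∨` locally flat-charted.** [cite: Schmid1973, §2] [cite: Deligne1982HodgeCycles, I Prop. 3.6 (proof)] -/
theorem dual (h : D.IsLocallyFlatCharted ψ σ) : D.dual.IsLocallyFlatCharted ψ σ := by
  refine ⟨fun a x hx => ?_, fun i => ?_⟩
  · obtain ⟨r, hr, hB, V, _, _, _, H₀, P₀, C, hC⟩ := h.interior a x hx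
    exact ⟨r, hr, hB, V, inferInstance, inferInstance, inferInstance, _, _, C.dual, hC.dual⟩
  · obtain ⟨V, _, _, _, L, C, hC⟩ := h.puncture i
    exact ⟨V, inferInstance, inferInstance, inferInstance, _, C.dual, hC.dual⟩

/-- **Constant variations are locally flat-charted** (no hypothesis on the discs). [cite: CattaniDeligneKaplan1995, (2.4), 2.7 (pp. 488–489)] -/
theorem const {M : Type} [AddCommGroup M] [Module.Finite ℤ M] [Module.Free ℤ M] {V : Type} [AddCommGroup V] [Module ℚ V] [FiniteDimensional ℚ V]
    {ι' : M →ₗ[ℤ] V} (hι : IsBaseChange ℚ ι') {n : ℤ} {H : HodgeStructure V n} (Q : H.Polarization) :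
    (VHSData.const S hι Q).IsLocallyFlatCharted ψ σ := by
  refine ⟨fun a x hx => ?_, fun i =>
    ⟨V, inferInstance, inferInstance, inferInstance, _, PunctureChart.const S hι Q (σ i), PunctureChart.isFlat_const S hι Q (σ i)⟩⟩
  obtain ⟨r, hr, hB⟩ := exists_ball_subset_target (ψ a) hx
  exact ⟨r, hr, hB, V, inferInstance, inferInstance, inferInstance, H, Q,
    InteriorChart.const S hι Q (restrBall (ψ a) x r) (isPreconnected_restrBall_target (ψ a) hB),
    InteriorChart.isFlat_const S hι Q (restrBall (ψ a) x r) (isPreconnected_restrBall_target (ψ a) hB)⟩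

/-- The Tate variation `ℤ_S(j)` is locally flat-charted. [cite: DeligneHodgeII1971, 2.1.13] [cite: CattaniDeligneKaplan1995, (2.4) (p. 488)] -/
theorem tate (j : ℤ) : (VHSData.tate S j).IsLocallyFlatCharted ψ σ := by
  refine ⟨fun a x hx => ?_, fun i =>
    ⟨ℚ, inferInstance, inferInstance, inferInstance, _, PunctureChart.tate S j (σ i), PunctureChart.isFlat_tate S j (σ i)⟩⟩
  obtain ⟨r, hr, hB⟩ := exists_ball_subset_target (ψ a) hx
  exact ⟨r, hr, hB, ℚ, inferInstance, inferInstance, inferInstance, _, _,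
    InteriorChart.tate S j (restrBall (ψ a) x r) (isPreconnected_restrBall_target (ψ a) hB),
    InteriorChart.isFlat_tate S j (restrBall (ψ a) x r) (isPreconnected_restrBall_target (ψ a) hB)⟩

/-- The unit variation `ℤ_S` is locally flat-charted. [cite: DeligneHodgeII1971, 2.1.13] [cite: CattaniDeligneKaplan1995, (2.4) (p. 488)] -/
theorem unit : (VHSData.unit S).IsLocallyFlatCharted ψ σ := by
  refine ⟨fun a x hx => ?_, fun i =>
    ⟨ℚ, inferInstance, inferInstance, inferInstance, _, PunctureChart.unit S (σ i), PunctureChart.isFlat_unit S (σ i)⟩⟩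
  obtain ⟨r, hr, hB⟩ := exists_ball_subset_target (ψ a) hx
  exact ⟨r, hr, hB, ℚ, inferInstance, inferInstance, inferInstance, _, _,
    InteriorChart.unit S (restrBall (ψ a) x r) (isPreconnected_restrBall_target (ψ a) hB),
    InteriorChart.isFlat_unit S (restrBall (ψ a) x r) (isPreconnected_restrBall_target (ψ a) hB)⟩

/-- **`D` locally flat-charted ⟹ every `D^{⊗m}` locally flat-charted.** [cite: CattaniDeligneKaplan1995, §1 (pp. 483–484)] [cite: Deligne1982HodgeCycles, I §3, 3.1–3.4] -/
theorem tensorPow (h : D.IsLocallyFlatCharted ψ σ) : ∀ m : ℕ, (D.tensorPow m).IsLocallyFlatCharted ψ σ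
  | 0 => unit.cast _
  | m + 1 => ((tensorPow h m).tensor h).cast _

/-- **`D` locally flat-charted ⟹ every `T^{a,b}D` locally flat-charted.** [cite: CattaniDeligneKaplan1995, §1 (pp. 483–484)] [cite: Deligne1982HodgeCycles, I §3, 3.1–3.4] -/
theorem tensorSpace (h : D.IsLocallyFlatCharted ψ σ) (a b : ℕ) : (D.tensorSpace a b).IsLocallyFlatCharted ψ σ :=
  (h.tensorPow a).tensor (h.dual.tensorPow b)

/-- **`D₁, D₂` locally flat-charted ⟹ `Hom(D₁, D₂)` locally flat-charted.** [cite: CattaniDeligneKaplan1995, §1 (p. 484)] [cite: Deligne1970, I.1] -/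
theorem hom {D₁ : VHSData S k₁} {D₂ : VHSData S k₂} (h₁ : D₁.IsLocallyFlatCharted ψ σ) (h₂ : D₂.IsLocallyFlatCharted ψ σ) :
    (D₁.hom D₂).IsLocallyFlatCharted ψ σ :=
  (h₁.dual.tensor h₂).cast _

/-! ## §5 Corollary 1.3 (`r = 1`) for locally flat-charted variations and their tensor constructions -/

/-- **CDK COROLLARY 1.3 (`r = 1`) FOR A LOCALLY FLAT-CHARTED VARIATION** over a preconnected `S` covered by the discs, with open ends beyond the heights
`A i`, a compact core, and end maps continuous on `{Im z > A i}`: for `p + p = k` and `u₀ ∈ V_ℤ,s₀`, **the set of `t ∈ S` where SOME determination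
`γ · u₀` is of type `(p, p)` is ALL of `S` or FINITE.** [cite: CattaniDeligneKaplan1995, Cor. 1.3 (p. 484), Thm. 1.5 and «Proof of 1.5 ⟹ 1.1» (p. 485)]
[cite: Schmid1973, §2 (cite only)] [cite: FritzscheGrauert2002, Ch. I §8] -/
theorem determinationLocus_eq_univ_or_finite [PreconnectedSpace S] (h : D.IsLocallyFlatCharted ψ σ) {p : ℤ} (hpk : p + p = k) {s₀ : S}
    (u₀ : D.VZ.fiber s₀) (hcov : ∀ x : S, ∃ a, x ∈ (ψ a).source) (A : ι → ℝ)
    (hopen : ∀ (i : ι) (A' : ℝ), A i ≤ A' → IsOpen (σ i '' {z : ℂ | A' < z.im}))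
    (hcore : ∀ A' : ι → ℝ, (∀ i, A i ≤ A' i) → ∃ K₀ : Set S, IsCompact K₀ ∧ K₀ ∪ ⋃ i, σ i '' {z : ℂ | A' i < z.im} = univ)
    (hcont : ∀ i, ContinuousOn (σ i) {z : ℂ | A i < z.im}) :
    {t : S | ∃ γ : Path.Homotopic.Quotient s₀ t, D.IsHodgeAt t p (D.VZ.transport γ u₀)} = univ ∨
      {t : S | ∃ γ : Path.Homotopic.Quotient s₀ t, D.IsHodgeAt t p (D.VZ.transport γ u₀)}.Finite := by
  set Z : Set S := {t : S | ∃ γ : Path.Homotopic.Quotient s₀ t, D.IsHodgeAt t p (D.VZ.transport γ u₀)} with hZ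
  have hend : ∀ i, ∃ A' : ℝ, A i ≤ A' ∧ ((∀ z : ℂ, A' ≤ z.im → σ i z ∈ Z) ∨ (∀ z : ℂ, A' ≤ z.im → σ i z ∉ Z)) := fun i => by
    obtain ⟨V, _, _, _, L, C, hC⟩ := h.puncture i
    obtain ⟨A', -, hA', hdich⟩ := hC.exists_forall_mem_determinationLocus_or_forall_not_mem (hcont i) hpk u₀
    exact ⟨A', hA', hdich⟩
  choose A' hA' hA using hend
  obtain ⟨K₀, hK₀, hcovK⟩ := hcore A' hA'
  refine Literature.Topology.eq_univ_or_finite_of_forall (fun x => ?_) hK₀ (E := fun i => σ i '' {z : ℂ | A' i < z.im})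
    (fun i => hopen i (A' i) (hA' i)) (by rw [hcovK]; exact subset_univ _) fun i => ?_
  · obtain ⟨a, hx⟩ := hcov x
    obtain ⟨r, hr, hB, V, _, _, _, H₀, P₀, C, hC⟩ := h.interior a x hx
    exact hC.mem_nhds_or_eventually_not_mem_determinationLocus hpk u₀ (mem_restrBall_source_self (ψ a) hx hr)
  · rcases hA i with hall | hnone
    · refine Or.inl ?_
      rintro _ ⟨z, hz, rfl⟩
      exact hall z (le_of_lt hz)
    · refine Or.inr (Set.disjoint_left.2 ?_)
      rintro _ ⟨z, hz, rfl⟩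
      exact hnone z (le_of_lt hz)

variable {X : Type*} [TopologicalSpace X] [CompactSpace X]

/-- **COR. 1.3 FOR A LOCALLY FLAT-CHARTED VARIATION OVER A PUNCTURED COMPACT CURVE** (ends, core and continuity of the ends from a compactification).
[cite: CattaniDeligneKaplan1995, Cor. 1.3 (p. 484), 2.3 (p. 487)] -/
theorem determinationLocus_eq_univ_or_finite_of_compactification [PreconnectedSpace S] (h : D.IsLocallyFlatCharted ψ σ) {p : ℤ}
    (hpk : p + p = k) {s₀ : S} (u₀ : D.VZ.fiber s₀) (hcov : ∀ x : S, ∃ a, x ∈ (ψ a).source) (A : ι → ℝ)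
    {j : S → X} (hj : IsEmbedding j) (pt : ι → X) (hpS : ∀ i, pt i ∉ range j) (hcovX : ∀ x : X, x ∉ range j → ∃ i, x = pt i)
    (φ : ι → OpenPartialHomeomorph X ℂ) (hp : ∀ i, pt i ∈ (φ i).source) (hφp : ∀ i, φ i (pt i) = 0)
    (hball : ∀ i, Metric.ball (0 : ℂ) (Real.exp (-(2 * Real.pi * A i))) ⊆ (φ i).target)
    (hσ : ∀ (i : ι) (z : ℂ), A i < z.im → j (σ i z) = (φ i).symm (Complex.exp (2 * Real.pi * Complex.I * z))) :
    {t : S | ∃ γ : Path.Homotopic.Quotient s₀ t, D.IsHodgeAt t p (D.VZ.transport γ u₀)} = univ ∨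
      {t : S | ∃ γ : Path.Homotopic.Quotient s₀ t, D.IsHodgeAt t p (D.VZ.transport γ u₀)}.Finite :=
  h.determinationLocus_eq_univ_or_finite hpk u₀ hcov A (Topology.isOpen_image_ends hj φ A hball σ hσ)
    (Topology.exists_isCompact_core hj pt hpS hcovX φ hp hφp A hball σ hσ) (continuousOn_end_lifts hj φ A hball σ hσ)

/-- **COR. 1.3 FOR EVERY `T^{a,b}D` OF A LOCALLY FLAT-CHARTED `D`** (in particular from flat holomorphic lifts, `of_lift`).
[cite: CattaniDeligneKaplan1995, Cor. 1.3 (p. 484)] [cite: Deligne1982HodgeCycles, I §3, 3.1–3.4] -/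
theorem determinationLocus_tensorSpace_eq_univ_or_finite [PreconnectedSpace S] (h : D.IsLocallyFlatCharted ψ σ) (a b : ℕ) {p : ℤ}
    (hpk : p + p = (a : ℤ) * k + (b : ℤ) * (-k)) {s₀ : S} (u₀ : (D.tensorSpace a b).VZ.fiber s₀) (hcov : ∀ x : S, ∃ a, x ∈ (ψ a).source)
    (A : ι → ℝ) (hopen : ∀ (i : ι) (A' : ℝ), A i ≤ A' → IsOpen (σ i '' {z : ℂ | A' < z.im}))
    (hcore : ∀ A' : ι → ℝ, (∀ i, A i ≤ A' i) → ∃ K₀ : Set S, IsCompact K₀ ∧ K₀ ∪ ⋃ i, σ i '' {z : ℂ | A' i < z.im} = univ)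
    (hcont : ∀ i, ContinuousOn (σ i) {z : ℂ | A i < z.im}) :
    {t : S | ∃ γ : Path.Homotopic.Quotient s₀ t, (D.tensorSpace a b).IsHodgeAt t p ((D.tensorSpace a b).VZ.transport γ u₀)} = univ ∨
      {t : S | ∃ γ : Path.Homotopic.Quotient s₀ t, (D.tensorSpace a b).IsHodgeAt t p ((D.tensorSpace a b).VZ.transport γ u₀)}.Finite :=
  (h.tensorSpace a b).determinationLocus_eq_univ_or_finite hpk u₀ hcov A hopen hcore hcont

/-- **COR. 1.3 FOR THE MULTIVALUED MORPHISM LOCUS `Hom(D₁, D₂)` of locally flat-charted `D₁`, `D₂`.** [cite: CattaniDeligneKaplan1995, Cor. 1.3 and §1 (p. 484)]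
[cite: Deligne1970, I.1] -/
theorem determinationLocus_hom_eq_univ_or_finite [PreconnectedSpace S] {D₁ : VHSData S k₁} {D₂ : VHSData S k₂} (h₁ : D₁.IsLocallyFlatCharted ψ σ)
    (h₂ : D₂.IsLocallyFlatCharted ψ σ) {p : ℤ} (hpk : p + p = k₂ - k₁) {s₀ : S} (u₀ : (D₁.hom D₂).VZ.fiber s₀)
    (hcov : ∀ x : S, ∃ a, x ∈ (ψ a).source) (A : ι → ℝ) (hopen : ∀ (i : ι) (A' : ℝ), A i ≤ A' → IsOpen (σ i '' {z : ℂ | A' < z.im}))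
    (hcore : ∀ A' : ι → ℝ, (∀ i, A i ≤ A' i) → ∃ K₀ : Set S, IsCompact K₀ ∧ K₀ ∪ ⋃ i, σ i '' {z : ℂ | A' i < z.im} = univ)
    (hcont : ∀ i, ContinuousOn (σ i) {z : ℂ | A i < z.im}) :
    {t : S | ∃ γ : Path.Homotopic.Quotient s₀ t, (D₁.hom D₂).IsHodgeAt t p ((D₁.hom D₂).VZ.transport γ u₀)} = univ ∨
      {t : S | ∃ γ : Path.Homotopic.Quotient s₀ t, (D₁.hom D₂).IsHodgeAt t p ((D₁.hom D₂).VZ.transport γ u₀)}.Finite :=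
  (h₁.hom h₂).determinationLocus_eq_univ_or_finite hpk u₀ hcov A hopen hcore hcont

/-- **COR. 1.3 FOR EVERY `T^{a,b}D` OF A LOCALLY FLAT-CHARTED `D` OVER A PUNCTURED COMPACT CURVE.** [cite: CattaniDeligneKaplan1995, Cor. 1.3 (p. 484), 2.3 (p. 487)] -/
theorem determinationLocus_tensorSpace_eq_univ_or_finite_of_compactification [PreconnectedSpace S] (h : D.IsLocallyFlatCharted ψ σ) (a b : ℕ)
    {p : ℤ} (hpk : p + p = (a : ℤ) * k + (b : ℤ) * (-k)) {s₀ : S} (u₀ : (D.tensorSpace a b).VZ.fiber s₀)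
    (hcov : ∀ x : S, ∃ a, x ∈ (ψ a).source) (A : ι → ℝ)
    {j : S → X} (hj : IsEmbedding j) (pt : ι → X) (hpS : ∀ i, pt i ∉ range j) (hcovX : ∀ x : X, x ∉ range j → ∃ i, x = pt i)
    (φ : ι → OpenPartialHomeomorph X ℂ) (hp : ∀ i, pt i ∈ (φ i).source) (hφp : ∀ i, φ i (pt i) = 0)
    (hball : ∀ i, Metric.ball (0 : ℂ) (Real.exp (-(2 * Real.pi * A i))) ⊆ (φ i).target)
    (hσ : ∀ (i : ι) (z : ℂ), A i < z.im → j (σ i z) = (φ i).symm (Complex.exp (2 * Real.pi * Complex.I * z))) :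
    {t : S | ∃ γ : Path.Homotopic.Quotient s₀ t, (D.tensorSpace a b).IsHodgeAt t p ((D.tensorSpace a b).VZ.transport γ u₀)} = univ ∨
      {t : S | ∃ γ : Path.Homotopic.Quotient s₀ t, (D.tensorSpace a b).IsHodgeAt t p ((D.tensorSpace a b).VZ.transport γ u₀)}.Finite :=
  (h.tensorSpace a b).determinationLocus_eq_univ_or_finite_of_compactification hpk u₀ hcov A hj pt hpS hcovX φ hp hφp hball hσ

end IsLocallyFlatCharted

/-! ## §6 Descent along a covering: flat charts of `f^*D` upstairs give Corollary 1.3 for `D`, `D₁ ⊗ D₂`, `T^{a,b}D`, `Hom(D₁, D₂)` downstairs -/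

namespace IsLocallyFlatCharted

variable {S' : Type} [TopologicalSpace S'] [PreconnectedSpace S'] (f : C(S', S))
variable {α' ι' : Type*} {ψ' : α' → OpenPartialHomeomorph S' ℂ} {σ' : ι' → ℂ → S'}

/-- **«To prove 1.1 one is free to replace `S` by a finite etale covering `S′ → S`», FOR COROLLARY 1.3**: if the pull-back `f^*D` along a SURJECTIVE
COVERING MAP `f : S′ → S` (`S′` preconnected) is locally flat-charted, with open ends, a compact core and continuous end maps upstairs, then for
`p + p = k` and `u₀ ∈ V_ℤ,f(s′₀)` the set of `t ∈ S` where some determination of `u₀` is of type `(p, p)` is ALL of `S` or FINITE (the determination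
locus downstairs is the image of the one upstairs: the tree's `determinationLocus_eq_univ_or_finite_of_comap_covering`, path lifting).
[cite: CattaniDeligneKaplan1995, Cor. 1.3 (p. 484) and «Proof of 1.5 ⟹ 1.1» (p. 485)] -/
theorem determinationLocus_eq_univ_or_finite_of_comap_covering (hf : IsCoveringMap f) (hsurj : Function.Surjective f)
    (h : (D.comap f).IsLocallyFlatCharted ψ' σ') {p : ℤ} (hpk : p + p = k) {s'₀ : S'} (u₀ : D.VZ.fiber (f s'₀))
    (hcov : ∀ x' : S', ∃ a, x' ∈ (ψ' a).source) (A : ι' → ℝ) (hopen : ∀ (i : ι') (A' : ℝ), A i ≤ A' → IsOpen (σ' i '' {z : ℂ | A' < z.im}))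
    (hcore : ∀ A' : ι' → ℝ, (∀ i, A i ≤ A' i) → ∃ K₀ : Set S', IsCompact K₀ ∧ K₀ ∪ ⋃ i, σ' i '' {z : ℂ | A' i < z.im} = univ)
    (hcont : ∀ i, ContinuousOn (σ' i) {z : ℂ | A i < z.im}) :
    {t : S | ∃ γ : Path.Homotopic.Quotient (f s'₀) t, D.IsHodgeAt t p (D.VZ.transport γ u₀)} = univ ∨
      {t : S | ∃ γ : Path.Homotopic.Quotient (f s'₀) t, D.IsHodgeAt t p (D.VZ.transport γ u₀)}.Finite :=
  D.determinationLocus_eq_univ_or_finite_of_comap_covering hf hsurj u₀ (h.determinationLocus_eq_univ_or_finite hpk u₀ hcov A hopen hcore hcont)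

/-- **COR. 1.3 FOR `D₁ ⊗ D₂` ON `S` FROM FLAT CHARTS OF `f^*D₁`, `f^*D₂` ON A COVERING** (`f^*(D₁ ⊗ D₂) = f^*D₁ ⊗ f^*D₂` on the nose).
[cite: CattaniDeligneKaplan1995, Cor. 1.3 (p. 484), «Proof of 1.5 ⟹ 1.1» (p. 485)] [cite: Deligne1970, I.1] -/
theorem determinationLocus_tensor_eq_univ_or_finite_of_comap_covering (hf : IsCoveringMap f) (hsurj : Function.Surjective f)
    {D₁ : VHSData S k₁} {D₂ : VHSData S k₂} (h₁ : (D₁.comap f).IsLocallyFlatCharted ψ' σ') (h₂ : (D₂.comap f).IsLocallyFlatCharted ψ' σ') {p : ℤ}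
    (hpk : p + p = k₁ + k₂) {s'₀ : S'} (u₀ : (D₁.tensor D₂).VZ.fiber (f s'₀)) (hcov : ∀ x' : S', ∃ a, x' ∈ (ψ' a).source) (A : ι' → ℝ)
    (hopen : ∀ (i : ι') (A' : ℝ), A i ≤ A' → IsOpen (σ' i '' {z : ℂ | A' < z.im}))
    (hcore : ∀ A' : ι' → ℝ, (∀ i, A i ≤ A' i) → ∃ K₀ : Set S', IsCompact K₀ ∧ K₀ ∪ ⋃ i, σ' i '' {z : ℂ | A' i < z.im} = univ)
    (hcont : ∀ i, ContinuousOn (σ' i) {z : ℂ | A i < z.im}) :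
    {t : S | ∃ γ : Path.Homotopic.Quotient (f s'₀) t, (D₁.tensor D₂).IsHodgeAt t p ((D₁.tensor D₂).VZ.transport γ u₀)} = univ ∨
      {t : S | ∃ γ : Path.Homotopic.Quotient (f s'₀) t, (D₁.tensor D₂).IsHodgeAt t p ((D₁.tensor D₂).VZ.transport γ u₀)}.Finite :=
  (D₁.tensor D₂).determinationLocus_eq_univ_or_finite_of_comap_covering hf hsurj u₀
    ((h₁.tensor h₂).determinationLocus_eq_univ_or_finite hpk u₀ hcov A hopen hcore hcont)

/-- **COR. 1.3 FOR `T^{a,b}D` ON `S` FROM FLAT CHARTS OF `f^*D` ON A COVERING `S′ → S`** (`f^*(T^{a,b}D) ≅ T^{a,b}(f^*D)`, the tree's `Iso.tensorSpaceComap`;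
determination loci are invariant under isomorphisms of VHS data, `Iso.setOf_exists_isHodgeAt_transport_eq`) — the shape of the proof on p. 483 ∕ 485 for
the «locus where some `α_s ∈ T^{a,b}` is Hodge»: pass to a finite étale cover with unipotent local monodromy, chart there, descend.
[cite: CattaniDeligneKaplan1995, Cor. 1.3 (p. 484), «Proof of 1.5 ⟹ 1.1» (p. 485)] [cite: Deligne1982HodgeCycles, I §3, 3.1–3.4] -/
theorem determinationLocus_tensorSpace_eq_univ_or_finite_of_comap_covering (hf : IsCoveringMap f) (hsurj : Function.Surjective f)
    (h : (D.comap f).IsLocallyFlatCharted ψ' σ') (a b : ℕ) {p : ℤ} (hpk : p + p = (a : ℤ) * k + (b : ℤ) * (-k)) {s'₀ : S'}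
    (u₀ : (D.tensorSpace a b).VZ.fiber (f s'₀)) (hcov : ∀ x' : S', ∃ a, x' ∈ (ψ' a).source) (A : ι' → ℝ)
    (hopen : ∀ (i : ι') (A' : ℝ), A i ≤ A' → IsOpen (σ' i '' {z : ℂ | A' < z.im}))
    (hcore : ∀ A' : ι' → ℝ, (∀ i, A i ≤ A' i) → ∃ K₀ : Set S', IsCompact K₀ ∧ K₀ ∪ ⋃ i, σ' i '' {z : ℂ | A' i < z.im} = univ)
    (hcont : ∀ i, ContinuousOn (σ' i) {z : ℂ | A i < z.im}) :
    {t : S | ∃ γ : Path.Homotopic.Quotient (f s'₀) t, (D.tensorSpace a b).IsHodgeAt t p ((D.tensorSpace a b).VZ.transport γ u₀)} = univ ∨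
      {t : S | ∃ γ : Path.Homotopic.Quotient (f s'₀) t, (D.tensorSpace a b).IsHodgeAt t p ((D.tensorSpace a b).VZ.transport γ u₀)}.Finite := by
  refine (D.tensorSpace a b).determinationLocus_eq_univ_or_finite_of_comap_covering hf hsurj u₀ ?_
  rw [← (Iso.tensorSpaceComap f D a b).setOf_exists_isHodgeAt_transport_eq s'₀ p u₀]
  exact (h.tensorSpace a b).determinationLocus_eq_univ_or_finite hpk _ hcov A hopen hcore hcont

/-- **COR. 1.3 FOR THE MULTIVALUED MORPHISM LOCUS `Hom(D₁, D₂)` (`D₁`, `D₂` of the same weight; `p = 0`: morphisms of Hodge structures continued along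
paths) ON `S` FROM FLAT CHARTS OF `f^*D₁`, `f^*D₂` ON A COVERING** (`f^*Hom(D₁, D₂) ≅ Hom(f^*D₁, f^*D₂)`, the tree's `Iso.homComap`).
[cite: CattaniDeligneKaplan1995, Cor. 1.3 and §1 (p. 484), «Proof of 1.5 ⟹ 1.1» (p. 485)] [cite: Deligne1970, I.1] -/
theorem determinationLocus_hom_eq_univ_or_finite_of_comap_covering (hf : IsCoveringMap f) (hsurj : Function.Surjective f)
    {D₁ D₂ : VHSData S k} (h₁ : (D₁.comap f).IsLocallyFlatCharted ψ' σ') (h₂ : (D₂.comap f).IsLocallyFlatCharted ψ' σ') {p : ℤ}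
    (hpk : p + p = k - k) {s'₀ : S'} (u₀ : (D₁.hom D₂).VZ.fiber (f s'₀)) (hcov : ∀ x' : S', ∃ a, x' ∈ (ψ' a).source) (A : ι' → ℝ)
    (hopen : ∀ (i : ι') (A' : ℝ), A i ≤ A' → IsOpen (σ' i '' {z : ℂ | A' < z.im}))
    (hcore : ∀ A' : ι' → ℝ, (∀ i, A i ≤ A' i) → ∃ K₀ : Set S', IsCompact K₀ ∧ K₀ ∪ ⋃ i, σ' i '' {z : ℂ | A' i < z.im} = univ)
    (hcont : ∀ i, ContinuousOn (σ' i) {z : ℂ | A i < z.im}) :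
    {t : S | ∃ γ : Path.Homotopic.Quotient (f s'₀) t, (D₁.hom D₂).IsHodgeAt t p ((D₁.hom D₂).VZ.transport γ u₀)} = univ ∨
      {t : S | ∃ γ : Path.Homotopic.Quotient (f s'₀) t, (D₁.hom D₂).IsHodgeAt t p ((D₁.hom D₂).VZ.transport γ u₀)}.Finite := by
  refine (D₁.hom D₂).determinationLocus_eq_univ_or_finite_of_comap_covering hf hsurj u₀ ?_
  rw [← (Iso.homComap f D₁ D₂).setOf_exists_isHodgeAt_transport_eq s'₀ p u₀]
  exact (h₁.hom h₂).determinationLocus_eq_univ_or_finite hpk _ hcov A hopen hcore hcont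

end IsLocallyFlatCharted

/-! ## §7 Locally flat-charted from POINTWISE flat holomorphic lifts (reference structure and lift normalised at each point) -/

namespace IsLocallyFlatCharted

/-- **Locally flat-charted from flat holomorphic lifts NORMALISED AT EACH POINT.**  Around every point `x` of every disc `ψ a`: a reference space `V`,
the polarized reference Hodge structure `(H₀, P₀)` AT `x`, flat identifications `e c : V_{(ψ a)⁻¹(c)} ≃ V` on the disc carrying every `F^q` to `g(c)·F₀^q`
with `g(c) → 1` weakly as `c → ψ a x` (`g`, `h` mutually inverse on the target, `h` weakly holomorphic), `Q` to `Q₀`, `V_ℤ` ONTO a finitely generated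
`Λ₀`, the `e_c` FLAT along every path inside the disc; flat puncture charts along the ends (existential).  Then `D` is locally flat-charted — the data
of `exists_isFlat_interiorChart_restrBall_of_lift` chosen per point, as flat frames and holomorphic lifts of the period map give them (`H₀ = Φ(ψ a x)`,
`g(c) = Φ̃(c)Φ̃(ψ a x)⁻¹`); `of_lift` is the special case of one datum per disc. [cite: CattaniDeligneKaplan1995, §1 (pp. 483–484), Cor. 1.3, (2.4) (p. 488)]
[cite: Schmid1973, §2–§3 (cite only)] [cite: CattaniKaplanSchmid1987, §3 proof of Cor. (3.7) (cite only)] -/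
theorem of_pointwise_lift
    (hint : ∀ a, ∀ x ∈ (ψ a).source, ∃ (V : Type) (_ : AddCommGroup V) (_ : Module ℚ V) (_ : FiniteDimensional ℚ V)
      (e : ∀ c : ℂ, D.V.fiber ((ψ a).symm c) ≃ₗ[ℚ] V) (H₀ : HodgeStructure V k) (P₀ : H₀.Polarization)
      (g h : ℂ → Module.End ℂ (ℂ ⊗[ℚ] V)) (Λ₀ : Submodule ℤ V),
      (∀ c ∈ (ψ a).target, ∀ w, g c (h c w) = w) ∧ (∀ c ∈ (ψ a).target, ∀ w, h c (g c w) = w) ∧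
      (∀ (φ : Module.Dual ℂ (ℂ ⊗[ℚ] V)) (w : ℂ ⊗[ℚ] V), AnalyticOnNhd ℂ (fun c => φ (h c w)) (ψ a).target) ∧
      (∀ (w : ℂ ⊗[ℚ] V) (φ : (ℂ ⊗[ℚ] V) →ₗ[ℂ] ℂ), Tendsto (fun c => φ (g c w)) (𝓝 (ψ a x)) (𝓝 (φ w))) ∧
      (∀ c ∈ (ψ a).target, ∀ q : ℤ, ((D.hodge ((ψ a).symm c)).F q).map ((e c).toLinearMap.baseChange ℂ) = (H₀.F q).map (g c)) ∧
      (∀ c ∈ (ψ a).target, ∀ x y : D.V.fiber ((ψ a).symm c), (D.form ((ψ a).symm c)).form x y = P₀.form (e c x) (e c y)) ∧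
      Λ₀.FG ∧ (∀ c ∈ (ψ a).target, ∀ u : D.VZ.fiber ((ψ a).symm c), e c (D.toRat ((ψ a).symm c) u) ∈ Λ₀) ∧
      (∀ c ∈ (ψ a).target, ∀ v ∈ Λ₀, ∃ u : D.VZ.fiber ((ψ a).symm c), e c (D.toRat ((ψ a).symm c) u) = v) ∧
      (∀ ⦃c c' : ℂ⦄, c ∈ (ψ a).target → c' ∈ (ψ a).target → ∀ γ : Path ((ψ a).symm c) ((ψ a).symm c'), (∀ t, γ t ∈ (ψ a).source) →
        ∀ y : D.V.fiber ((ψ a).symm c), e c' (D.V.transport (Path.Homotopic.Quotient.mk γ) y) = e c y))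
    (hpunct : ∀ i, ∃ (V : Type) (_ : AddCommGroup V) (_ : Module ℚ V) (_ : FiniteDimensional ℚ V) (L : PolarizedLimitMixedHodgeStructure V k)
      (C : D.PunctureChart (σ i) L), C.IsFlat) :
    D.IsLocallyFlatCharted ψ σ := by
  refine ⟨fun a x hx => ?_, hpunct⟩
  obtain ⟨V, _, _, _, e, H₀, P₀, g, h, Λ₀, hgh, hhg, hh, hg1, hF, hQ, hΛ, hΛ₁, hΛ₂, hflat⟩ := hint a x hx
  obtain ⟨r, hr, hB, C, hC⟩ :=
    D.exists_isFlat_interiorChart_restrBall_of_lift (ψ a) hx e H₀ P₀ g h hgh hhg hh hg1 hF hQ Λ₀ hΛ hΛ₁ hΛ₂ hflat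
  exact ⟨r, hr, hB, V, inferInstance, inferInstance, inferInstance, H₀, P₀, C, hC⟩

end IsLocallyFlatCharted

/-! ## §8 Interior charts only, ANY preconnected base: everything, or closed and discrete -/

namespace IsLocallyCharted

/-- **EVERYTHING, OR CLOSED AND DISCRETE — from interior charts alone.**  On a preconnected `S` covered by the discs `ψ a` (no hypothesis on ends or
cores: e.g. a disc, the half-plane), for `p + p = k` the Hodge locus of norm `≤ K` of a locally charted `D` is CLOSED, and is either ALL of `S` or
such that every point of `S` has a punctured neighbourhood avoiding it («locally on `S`, `S^{(K)}` is a finite disjoint sum of closed analytic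
subspaces»; in one variable a proper analytic subset is discrete). [cite: CattaniDeligneKaplan1995, §1 (p. 484), Thm. 1.1] [cite: FritzscheGrauert2002, Ch. I §8 (after Prop. 8.1, n = 1)] -/
theorem isClosed_hodgeLocusOfNormLe_and_eq_univ_or_forall_eventually_not_mem [PreconnectedSpace S] (h : D.IsLocallyCharted ψ σ) {p : ℤ}
    (hpk : p + p = k) (K : ℤ) (hcov : ∀ x : S, ∃ a, x ∈ (ψ a).source) :
    IsClosed (D.hodgeLocusOfNormLe p K) ∧
      (D.hodgeLocusOfNormLe p K = univ ∨ ∀ x : S, ∀ᶠ y in 𝓝[≠] x, y ∉ D.hodgeLocusOfNormLe p K) := by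
  have hloc : ∀ x : S, D.hodgeLocusOfNormLe p K ∈ 𝓝 x ∨ ∀ᶠ y in 𝓝[≠] x, y ∉ D.hodgeLocusOfNormLe p K := fun x => by
    obtain ⟨a, hx⟩ := hcov x
    obtain ⟨r, hr, hB, V, _, _, _, H₀, P₀, ⟨C⟩⟩ := h.interior a x hx
    exact C.mem_nhds_or_eventually_not_mem hpk K (mem_restrBall_source_self (ψ a) hx hr)
  have hcl := Literature.Topology.isClosed_of_forall_mem_nhds_or_eventually_not_mem hloc
  exact ⟨hcl, Literature.Topology.eq_univ_or_forall_eventually_not_mem hcl fun x _ => hloc x⟩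

end IsLocallyCharted

namespace IsLocallyFlatCharted

/-- **COROLLARY 1.3 FROM FLAT INTERIOR CHARTS ALONE, ANY PRECONNECTED BASE: everything, or closed and discrete.**  On a preconnected `S` covered by the
discs `ψ a`, for `p + p = k` and `u₀ ∈ V_ℤ,s₀`, the set of `t` where SOME determination of `u₀` is of type `(p, p)` is CLOSED and is either ALL of `S`
or such that every point of `S` has a punctured neighbourhood avoiding it (an analytic subvariety of a curve: all or discrete).
[cite: CattaniDeligneKaplan1995, Cor. 1.3 (p. 484)] [cite: FritzscheGrauert2002, Ch. I §8 (after Prop. 8.1, n = 1)] -/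
theorem isClosed_determinationLocus_and_eq_univ_or_forall_eventually_not_mem [PreconnectedSpace S] (h : D.IsLocallyFlatCharted ψ σ) {p : ℤ}
    (hpk : p + p = k) {s₀ : S} (u₀ : D.VZ.fiber s₀) (hcov : ∀ x : S, ∃ a, x ∈ (ψ a).source) :
    IsClosed {t : S | ∃ γ : Path.Homotopic.Quotient s₀ t, D.IsHodgeAt t p (D.VZ.transport γ u₀)} ∧
      ({t : S | ∃ γ : Path.Homotopic.Quotient s₀ t, D.IsHodgeAt t p (D.VZ.transport γ u₀)} = univ ∨
        ∀ x : S, ∀ᶠ y in 𝓝[≠] x, y ∉ {t : S | ∃ γ : Path.Homotopic.Quotient s₀ t, D.IsHodgeAt t p (D.VZ.transport γ u₀)}) := by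
  set Z : Set S := {t : S | ∃ γ : Path.Homotopic.Quotient s₀ t, D.IsHodgeAt t p (D.VZ.transport γ u₀)} with hZ
  have hloc : ∀ x : S, Z ∈ 𝓝 x ∨ ∀ᶠ y in 𝓝[≠] x, y ∉ Z := fun x => by
    obtain ⟨a, hx⟩ := hcov x
    obtain ⟨r, hr, hB, V, _, _, _, H₀, P₀, C, hC⟩ := h.interior a x hx
    exact hC.mem_nhds_or_eventually_not_mem_determinationLocus hpk u₀ (mem_restrBall_source_self (ψ a) hx hr)
  have hcl := Literature.Topology.isClosed_of_forall_mem_nhds_or_eventually_not_mem hloc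
  exact ⟨hcl, Literature.Topology.eq_univ_or_forall_eventually_not_mem hcl fun x _ => hloc x⟩

end IsLocallyFlatCharted

end Motives.VHSData

end Literature.AlgebraicGeometry

end
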